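import Summits.BirchSwinnertonDyer.BirchSwinnertonDyer.Theorems.SmallImageMuTransferMuTransferX9KolyvaginPackage
import Summits.BirchSwinnertonDyer.BirchSwinnertonDyer.Theorems.OneSidedTwistSqueezeX9KatoDivisibilityX9ChebotarevPk
import Literature.NumberTheory.EllipticCurves.Kato2004.IwasawaH1ReductionTowerPk
import Literature.NumberTheory.EllipticCurves.IwasawaTwistModPkDual
import HarnessLib

set_option autoImplicit false

-- the summit and its single problem are both named `BirchSwinnertonDyer` (registry layout D-0017)
set_option linter.dupNamespace false

/-!
# Stub `stub_reciprocityPkX9` (hG34ᵍ) of line `graded_euler_loss`, crux `KatoDivisibilityX9`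
# (stmt-BirchSwinnertonDyer-20547): cocycle bookkeeping at an `E[p^{d+1}]`-split Frobenius for the level-`p^k`
# twists `𝒯_J^{(k)}(E)` — split elements act unipotently, inertia acts trivially, unramified classes have cocycles
# vanishing on inertia, the level-`p^{d+1}` reduction of `p^d s'`, and the truncation of its mod-`p` shadow to the
# cocycle `S^a Φ` of the stub

Seat `bsd-line-k6-p4` (prover-bsd-line-k6-p4-g5-0, stub worker for `stub_reciprocityPkX9`).  THEOREMS ONLY, sorry-free;
no definition, no named fact, nothing asserted about any particular curve.  `--supports stmt-BirchSwinnertonDyer-20547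
--as helper`.  The level-`p^k` twins of the `n = 0` cocycle seams used by `KolyvaginPackage.exists_kolyvaginPackage` and
`StepsTwoFour.stub_stepsTwoFourOdd_of` (files `…StepFourCocycleSeams`, `…LocalTwistOperator`,
`…StepsTwoFourTransportDistinguished`), over the T-es-6 carriers `WeierstrassCurve.modPkTwist` (T6a) and
`IwasawaH1Data.redTowerPk` (T6c):

* §1 `smul_eq_of_galoisRepTorsion_eq_one`, `torsionGaloisModule_eq_one_of_galoisRepTorsion_eq_one`,
  `galoisRepTorsion_natCast_eq_one_of_pow` — `ρ_{E,p^{d+1}}(σ) = 1` in the three currencies, and `⟹ ρ̄_{E,p}(σ) = 1`.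
* §2 `modPkTwist_apply_of_forall_smul_eq` — an `E[p^k]`-split `σ` acts on `𝒯_J^{(k)}` by `(1+S)^{κ(σ)}` alone;
  `exists_modPTwist_sub_eq_shiftEnd_pow` — on the mod-`p` twist an `E[p]`-split `σ ∈ Γ_N` has
  `σb − b ∈ S^{p^N}𝒯_J` (the `n = 0` seam `hcob` of `exists_kolyvaginPackage`, isolated).
* §3 `toLocal_modPkTwist_apply_of_mem_absInertia` (inertia at `q ∤ p` with `E[p^k]` unramified acts trivially on the
  local twist), `apply_absGaloisRestrict_eq_zero_of_unramified_modPkTwist` (a cocycle of a class unramified at `q`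
  vanishes identically on `I_q`).
* §4 `redTowerPk_apply_C_pow_smul` — `red^{(k)}(p^d · x)_J = p^d • red^{(k)}(x)_J`; `oneCocycleClass_nsmul`.
* §5 `exists_coboundary_castLE_geomTorsionPowToModP_eq` — for a cocycle `φ'` of `red^{(d+1)}(s')_{J+1}` and the stub's
  `Φ` (`[Φ] = κ'_{2e}`, `T^a κ' = red(s')`): `p^d ∘ φ' mod T^{2e} = S^a Φ + ∂b₁` pointwise, for some `b₁ ∈ 𝒯_{2e}(E[p])`.
* §6 `exists_coboundary_of_oneCocycleClass_eq` (two cocycles of one class differ by a coboundary, pointwise) and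
  `exists_coboundary_nsmul_sub_map` (`p^d Ψ̃ − ι ∘ ψ̃ = ∂b` from `p^d [Ψ̃] = ι_*[ψ̃]`).
* §7 `powWeilPairingHom_self` / `_right_nondegenerate` / `_smul_smul` — the T6d pairing hom of a Weil pairing at level
  `p^k` is alternating, right-non-degenerate and equivariant (the hypotheses of the package's `e_k`).

HONEST LABEL: bookkeeping; the stub `stub_reciprocityPkX9` stays OPEN; crux 20547 / B2 untouched; BSD is not advanced.

References: K. Kato, Astérisque 295 (2004) §13.8 [Kato2004Asterisque]; B. Mazur, K. Rubin, Mem. AMS 799 (2004) §5.3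
[MazurRubin2004]; J.-P. Serre, *Galois Cohomology* I §2 [SerreGaloisCohomology1997]; L. Washington, GTM 83 §13.1–13.2
[Washington1997]; J. S. Milne, ADT I §2 [MilneADT2006].
-/

noncomputable section

open scoped NumberField ContRepresentation
open Polynomial Field IsDedekindDomain
open Literature.NumberTheory.GaloisRepresentations
open Literature.NumberTheory.GaloisRepresentations.IsNonarchimedeanLocalField
open Literature.NumberTheory.EllipticCurves
open Literature.NumberTheory.EllipticCurves.Kato2004
open Literature.NumberTheory.EllipticCurves.Kato2004.EulerSystemValues
open WeierstrassCurve (geomPoints geomTorsion galoisRepTorsion)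
open Summit.BirchSwinnertonDyer.BirchSwinnertonDyer.Rank1Residual

namespace Summit.BirchSwinnertonDyer.BirchSwinnertonDyer.Theorems.OneSidedTwistSqueezeX9KatoDivisibilityX9StubReciprocityPkX9Local

universe u

/-! ## §1 `E[n]`-split elements in three currencies -/

section Split

variable {F : Type u} [Field F] (W : WeierstrassCurve F)

/-- `σ • P = P` on `E[n]` from `ρ_{E,n}(σ) = 1` (any integer level `n`, e.g. `(p:ℤ)^(d+1)`). [folklore] -/
theorem smul_eq_of_galoisRepTorsion_eq_one {n : ℤ} {σ : absoluteGaloisGroup F} (h : galoisRepTorsion W n σ = 1)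
    (P : geomTorsion W n) : σ • P = P := by
  rw [← WeierstrassCurve.galoisRepTorsion_apply, h]
  rfl

/-- `ρ_{E,n}(σ) = 1` as an equality of the discrete Galois module operator. [folklore] -/
theorem torsionGaloisModule_eq_one_of_galoisRepTorsion_eq_one {n : ℤ} {σ : absoluteGaloisGroup F}
    (h : galoisRepTorsion W n σ = 1) : W.torsionGaloisModule n σ = 1 :=
  LinearMap.ext fun P => by
    rw [WeierstrassCurve.torsionGaloisModule_apply_apply, smul_eq_of_galoisRepTorsion_eq_one W h P, Module.End.one_apply]

/-- An `E[p^{d+1}]`-split element is `E[p]`-split. [folklore] -/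
theorem galoisRepTorsion_natCast_eq_one_of_pow (p d : ℕ) {σ : absoluteGaloisGroup F}
    (h : galoisRepTorsion W ((p : ℤ) ^ (d + 1)) σ = 1) : galoisRepTorsion W (p : ℤ) σ = 1 :=
  (MonoidHom.mem_ker).mp
    (OneSidedTwistSqueezeX9KatoDivisibilityX9ChebotarevPk.ker_galoisRepTorsion_pow_le W p (Nat.succ_le_succ (Nat.zero_le d))
      ((MonoidHom.mem_ker).mpr h))

end Split

/-! ## §2 Split elements act unipotently on the twists -/

section Unipotent

variable {F : Type u} [Field F] (W : WeierstrassCurve F) (p : ℕ) [Fact p.Prime] (κ₁ : ZpExtension F p)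

/-- **An `E[p^k]`-split `σ` acts on `𝒯_J^{(k)}(E)` by the unipotent operator `(1+S)^{κ(σ) mod p^{J+k}}` alone.**
[cite: Washington1997, §13.1–§13.2] -/
theorem modPkTwist_apply_of_forall_smul_eq (k J : ℕ) {σ : absoluteGaloisGroup F}
    (hσ : ∀ P : geomTorsion W ((p : ℤ) ^ k), σ • P = P) (b : Fin J → geomTorsion W ((p : ℤ) ^ k)) :
    W.modPkTwist p k κ₁ J σ b = unipotentPow (geomTorsion W ((p : ℤ) ^ k)) J (κ₁.twistExponent (J + k) σ) b := by
  rw [WeierstrassCurve.modPkTwist_apply]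
  congr 1
  funext i
  exact hσ (b i)

/-- **On the mod-`p` twist, an `E[p]`-split `σ ∈ Γ_N` (`N ≤ J`) moves every vector into `S^{p^N}𝒯_J`:
`σb − b = S^{p^N} y`** (`(1+S)^{p^N u} − 1 = S^{p^N}·V(S)`). [cite: Washington1997, §13.2 (arithmetic in Λ/(p, T^n))] -/
theorem exists_modPTwist_sub_eq_shiftEnd_pow {N J : ℕ} (hNJ : N ≤ J) {σ : absoluteGaloisGroup F}
    (hσ : ∀ P : geomTorsion W (p : ℤ), σ • P = P) (hσN : σ ∈ κ₁.layerSubgroup N)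
    (b : Fin J → geomTorsion W (p : ℤ)) :
    ∃ y : Fin J → geomTorsion W (p : ℤ),
      W.modPTwist p κ₁ J σ b - b = (shiftEnd (geomTorsion W (p : ℤ)) J ^ (p ^ N)) y := by
  obtain ⟨w, hw⟩ := κ₁.prime_pow_dvd_twistExponent hNJ hσN
  obtain ⟨V', -, hV'⟩ := KolyvaginTwist.exists_poly_unipotentPow_sub_one_eq
    (M := geomTorsion W (p : ℤ)) (fun P => AddSubgroup.torsionBy.nsmul P) (J := J) N w
  refine ⟨aeval (shiftEnd (geomTorsion W (p : ℤ)) J) V' b, ?_⟩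
  have h1 : W.modPTwist p κ₁ J σ b = unipotentPow (geomTorsion W (p : ℤ)) J (p ^ N * w) b := by
    rw [WeierstrassCurve.modPTwist_apply, hw]
    congr 1
    funext i
    exact hσ (b i)
  rw [h1, ← Module.End.mul_apply, ← hV', LinearMap.sub_apply, Module.End.one_apply]

end Unipotent

/-! ## §3 Inertia at a good prime `q ∤ p` -/

section Inertia

variable (W : WeierstrassCurve ℚ) (p : ℕ) [Fact p.Prime] (κ₁ : ZpExtension ℚ p) (k J : ℕ)
  (q : HeightOneSpectrum (𝓞 ℚ))

/-- **The local inertia group at `q` acts trivially on `𝒯_J^{(k)}(E)`** when `E[p^k]` is unramified at `q` and `q ∤ p`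
(the twist character is unramified away from `p`). [cite: Washington1997, Prop. 13.2] -/
theorem toLocal_modPkTwist_apply_of_mem_absInertia
    (hur : GaloisRep.IsUnramifiedAt q (W.torsionGaloisModule ((p : ℤ) ^ k))) (hqp : (p : 𝓞 ℚ) ∉ q.asIdeal)
    {τ : absoluteGaloisGroup (q.adicCompletion ℚ)} (hτ : τ ∈ absInertia (q.adicCompletion ℚ))
    (x : Fin J → geomTorsion W ((p : ℤ) ^ k)) :
    GaloisRep.toLocal q (W.modPkTwist p k κ₁ J) τ x = x := by
  rw [GaloisRep.toLocal_apply, WeierstrassCurve.modPkTwist_apply,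
    LocalSplitPrime.twistExponent_eq_zero_of_apply_eq_one κ₁ (J + k)
      (LocalSplitPrime.apply_absGaloisRestrict_eq_one_of_mem_absInertia κ₁ q hqp hτ), unipotentPow,
    pow_zero, Module.End.one_apply]
  funext i
  have h := LinearMap.congr_fun ((GaloisRep.isUnramifiedAt_iff_toLocal_holds q _).1 hur τ hτ) (x i)
  rw [GaloisRep.toLocal_apply, WeierstrassCurve.torsionGaloisModule_apply_apply, Module.End.one_apply] at h
  exact h

/-- **A cocycle of a class of `𝒯_J^{(k)}(E)` unramified at `q` vanishes identically on `I_q`** (`q ∤ p`, `E[p^k]`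
unramified at `q`): `H¹_ur = ker(H¹(ℚ_q, ·) → H¹(I_q, ·))` and coboundaries vanish on a trivially acting subgroup.
[cite: MilneADT2006, Ch. I §2 (unramified cohomology)] -/
theorem apply_absGaloisRestrict_eq_zero_of_unramified_modPkTwist
    (hur : GaloisRep.IsUnramifiedAt q (W.torsionGaloisModule ((p : ℤ) ^ k))) (hqp : (p : 𝓞 ℚ) ∉ q.asIdeal)
    (c : contOneCocycles (W.modPkTwist p k κ₁ J).toTopRep)
    (hc : galoisCohomology.localization (W.modPkTwist p k κ₁ J) (Sum.inr q) 1
        (oneCocycleClass (W.modPkTwist p k κ₁ J).toTopRep c) ∈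
      DiscreteGaloisModule.unramifiedSubgroup (GaloisRep.toLocal q (W.modPkTwist p k κ₁ J)) 1)
    {τ : absoluteGaloisGroup (q.adicCompletion ℚ)} (hτ : τ ∈ absInertia (q.adicCompletion ℚ)) :
    c.1 (absGaloisRestrict ℚ (q.adicCompletion ℚ) τ) = 0 := by
  rw [StepFour.localization_oneCocycleClass] at hc
  exact (Summit.BirchSwinnertonDyer.Rank1Residual.X11b.LocBridge.mem_unramifiedSubgroup_one_iff_forall_eq_zero
    (GaloisRep.toLocal q (W.modPkTwist p k κ₁ J))
    (fun t ht w => toLocal_modPkTwist_apply_of_mem_absInertia W p κ₁ k J q hur hqp ht w) _).1 hc τ hτ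

end Inertia

/-! ## §4 The level-`p^k` reduction of `p^d · x` and classes of multiples of cocycles -/

section Reduction

variable (W : WeierstrassCurve ℚ) [W.IsElliptic] (p : ℕ) [Fact p.Prime] [ContinuousSMul ℤ_[p] (W.tateModule p)]
  {κ : ZpExtension ℚ p} {γ : absoluteGaloisGroup ℚ} (I : IwasawaH1Data W p κ γ)

/-- **`red^{(k)}((p)^d · x)_J = p^d • red^{(k)}(x)_J`** (`(PowerSeries.C p)^d • x = p^d • x` in the `Λ`-module `𝐇¹`
and `redTowerPk` is additive). [cite: Kato2004Asterisque, §13.8 (pp. 228–229)] -/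
theorem redTowerPk_apply_C_pow_smul (k d : ℕ) (x : I.H) (J : ℕ) :
    (I.redTowerPk k ((PowerSeries.C (p : ℤ_[p]) : IwasawaAlgebra p) ^ d • x) : ∀ J : ℕ,
        galoisCohomology (κ.twistModPk (W.torsionGaloisModule ((p : ℤ) ^ k)) (W.pow_nsmul_geomTorsion_eq_zero p k) J) 1) J =
      p ^ d • (I.redTowerPk k x : ∀ J : ℕ,
        galoisCohomology (κ.twistModPk (W.torsionGaloisModule ((p : ℤ) ^ k)) (W.pow_nsmul_geomTorsion_eq_zero p k) J) 1) J := by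
  have h : ((PowerSeries.C (p : ℤ_[p]) : IwasawaAlgebra p) ^ d • x) = (p ^ d : ℕ) • x := by
    rw [← map_pow, ← Nat.cast_pow, map_natCast, Nat.cast_smul_eq_nsmul]
  rw [h, map_nsmul, AddSubmonoidClass.coe_nsmul, Pi.smul_apply]

end Reduction

section Classes

variable {R : Type*} [CommRing R] [TopologicalSpace R] {G : Type*} [Group G] [TopologicalSpace G]
  [IsTopologicalGroup G] (X : TopRep R G)

/-- `[n • φ] = n • [φ]` for a continuous cocycle `φ`. [cite: SerreGaloisCohomology1997, I §2.2] -/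
theorem oneCocycleClass_nsmul (n : ℕ) (φ : contOneCocycles X) :
    oneCocycleClass X (n • φ) = n • oneCocycleClass X φ :=
  map_nsmul (oneCocycleClassₗ X) n φ

/-- **Two cocycles of the same class differ by a coboundary, pointwise**: `φ g = ψ g + (g·b − b)`.
[cite: SerreGaloisCohomology1997, I §2.2] -/
theorem exists_coboundary_of_oneCocycleClass_eq {φ ψ : contOneCocycles X}
    (h : oneCocycleClass X φ = oneCocycleClass X ψ) :
    ∃ b : X, ∀ g : G, φ.1 g = ψ.1 g + (X.ρ g b - b) := by
  have h0 : oneCocycleClass X (φ - ψ) = 0 := by rw [oneCocycleClass_sub, h, sub_self]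
  obtain ⟨b, hb⟩ := (oneCocycleClass_eq_zero_iff X _).mp h0
  refine ⟨b, fun g => ?_⟩
  have := hb g
  rw [Submodule.coe_sub, ContinuousMap.sub_apply, sub_eq_iff_eq_add'] at this
  exact this

end Classes

/-! ## §5 The mod-`p` shadow of the level-`p^{d+1}` reduction of `s'`, truncated to level `2e`, against `S^a Φ` -/

section Shadow

variable (W : WeierstrassCurve ℚ) [W.IsElliptic] (p : ℕ) [Fact p.Prime] [ContinuousSMul ℤ_[p] (W.tateModule p)]
  {κ : ZpExtension ℚ p} {γ : absoluteGaloisGroup ℚ} (I : IwasawaH1Data W p κ γ)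

/-- **`p^d ∘ φ' mod T^{J₂} = S^a Φ + ∂b₁`.**  For a cocycle `φ'` of the level-`p^{d+1}` class `red^{(d+1)}(s')_{L}`, the
stub's cocycle `Φ` of `κ'_{J₂}` with `T^a κ' = red(s')` and `J₂ ≤ L`: the coordinatewise reduction `P ↦ p^d P` of `φ'`
truncated to level `J₂` and the shifted cocycle `S^a Φ` have the same class `red(s')_{J₂}`
(`twistTowerPkToModP_redTowerPk`, tower compatibility, `towerShift_iterate_apply_coe`), hence differ pointwise by a
coboundary. [cite: Kato2004Asterisque, §13.8 (pp. 228–229)] [cite: SerreGaloisCohomology1997, I §2.2] -/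
theorem exists_coboundary_castLE_geomTorsionPowToModP_eq (d : ℕ) (s' : I.H) (a : ℕ)
    (κ' : κ.twistTower (W.torsionGaloisModule (p : ℤ)) (fun P : geomTorsion W (p : ℤ) => AddSubgroup.torsionBy.nsmul P))
    (hκ'a : (κ.towerShift (W.torsionGaloisModule (p : ℤ))
        (fun P : geomTorsion W (p : ℤ) => AddSubgroup.torsionBy.nsmul P))^[a] κ' = I.redTower s')
    {J₂ L : ℕ} (hJL : J₂ ≤ L) (Φ : contOneCocycles (W.modPTwist p κ J₂).toTopRep)
    (hΦ : oneCocycleClass (W.modPTwist p κ J₂).toTopRep Φ = κ'.1 J₂)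
    (φ' : contOneCocycles (W.modPkTwist p (d + 1) κ L).toTopRep)
    (hφ' : oneCocycleClass (W.modPkTwist p (d + 1) κ L).toTopRep φ' = (I.redTowerPk (d + 1) s').1 L) :
    ∃ b₁ : Fin J₂ → geomTorsion W (p : ℤ), ∀ g : absoluteGaloisGroup ℚ,
      (fun l : Fin J₂ => W.geomTorsionPowToModP p d (φ'.1 g (Fin.castLE hJL l))) =
        (shiftEnd (geomTorsion W (p : ℤ)) J₂ ^ a) (Φ.1 g) + (W.modPTwist p κ J₂ g b₁ - b₁) := by
  -- the mod-`p` shadow `p^d ∘ φ'` at level `L`: a cocycle of `red(s')_L`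
  let f := κ.twistModPkToModP (W.torsionGaloisModule ((p : ℤ) ^ (d + 1))) (W.pow_nsmul_geomTorsion_eq_zero p (d + 1)) L
    (W.torsionGaloisModule (p : ℤ)) (fun P : geomTorsion W (p : ℤ) => AddSubgroup.torsionBy.nsmul P)
    (W.torsionPowToModP p d)
  let φbar : contOneCocycles (W.modPTwist p κ L).toTopRep :=
    contOneCocycles.pullback (ContinuousMonoidHom.id (absoluteGaloisGroup ℚ))
      (X := (W.modPkTwist p (d + 1) κ L).toTopRep) (Y := (W.modPTwist p κ L).toTopRep)
      (TopRep.ofHom ⟨f.toContinuousLinearMap, f.isIntertwining'⟩) φ'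
  have hφbar : oneCocycleClass (W.modPTwist p κ L).toTopRep φbar = (I.redTower s').1 L := by
    have h1 : galoisCohomology.map f 1 (oneCocycleClass (W.modPkTwist p (d + 1) κ L).toTopRep φ') =
        oneCocycleClass (W.modPTwist p κ L).toTopRep φbar :=
      galoisCohomology.map_oneCocycleClass_ofHom f φ'
    rw [hφ'] at h1
    have h2 := I.twistTowerPkToModP_redTowerPk d s'
    have h3 := congrArg (fun x : κ.twistTower (W.torsionGaloisModule (p : ℤ)) _ => x.1 L) h2
    simp only [ZpExtension.twistTowerPkToModP_apply_coe] at h3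
    exact h1.symm.trans h3
  -- truncate to level `J₂` and compare with `S^a Φ`
  let φtr : contOneCocycles (W.modPTwist p κ J₂).toTopRep :=
    κ.pushCocycle (W.torsionGaloisModule (p : ℤ)) (fun P : geomTorsion W (p : ℤ) => AddSubgroup.torsionBy.nsmul P) L
      (κ.twistModPTruncate (W.torsionGaloisModule (p : ℤ)) _ L hJL) φbar
  have hclass : oneCocycleClass (W.modPTwist p κ J₂).toTopRep φtr =
      oneCocycleClass (W.modPTwist p κ J₂).toTopRep
        (κ.shiftPowCocycle (W.torsionGaloisModule (p : ℤ))
          (fun P : geomTorsion W (p : ℤ) => AddSubgroup.torsionBy.nsmul P) J₂ a Φ) := by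
    have e1 : galoisCohomology.map (κ.twistModPTruncate (W.torsionGaloisModule (p : ℤ))
        (fun P : geomTorsion W (p : ℤ) => AddSubgroup.torsionBy.nsmul P) L hJL) 1
        (oneCocycleClass (W.modPTwist p κ L).toTopRep φbar) =
        oneCocycleClass (W.modPTwist p κ J₂).toTopRep φtr :=
      ZpExtension.map_oneCocycleClass_twist κ (W.torsionGaloisModule (p : ℤ))
        (fun P : geomTorsion W (p : ℤ) => AddSubgroup.torsionBy.nsmul P) L
        (κ.twistModPTruncate (W.torsionGaloisModule (p : ℤ)) _ L hJL) φbar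
    have e2 : galoisCohomology.map (κ.twistModPTruncate (W.torsionGaloisModule (p : ℤ))
        (fun P : geomTorsion W (p : ℤ) => AddSubgroup.torsionBy.nsmul P) L hJL) 1 ((I.redTower s').1 L) =
        (I.redTower s').1 J₂ := (I.redTower s').2 _ _ hJL
    rw [← e1, hφbar, e2, ← hκ'a, ZpExtension.towerShift_iterate_apply_coe, ← hΦ]
    exact ZpExtension.shiftH1_iterate_oneCocycleClass κ _ _ J₂ a Φ
  obtain ⟨b₁, hb₁⟩ := exists_coboundary_of_oneCocycleClass_eq _ hclass
  refine ⟨b₁, fun g => ?_⟩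
  have h := hb₁ g
  rw [ZpExtension.pushCocycle_apply, ZpExtension.shiftPowCocycle_apply] at h
  exact h

end Shadow

/-! ## §6 The test side: `p^d Ψ̃ = ι ∘ ψ̃ + ∂b` -/

section TestSide

variable (W : WeierstrassCurve ℚ) (p : ℕ) [Fact p.Prime] (κ₁ : ZpExtension ℚ p) (d L : ℕ)

/-- **`p^d Ψ̃ = ι ∘ ψ̃ + ∂b` pointwise** from the class identity `p^d [Ψ̃] = ι_* [ψ̃]` of the graded test pair
(`ι : E[p] ⊂ E[p^{d+1}]`, `ι_* = H¹(twistModPToModPk ι)`). [cite: SerreGaloisCohomology1997, I §2.2] [cite: MazurRubin2004, §5.3] -/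
theorem exists_coboundary_nsmul_sub_map
    (ι : (W.torsionGaloisModule (p : ℤ)).toContRepresentation →ⁱL
      (W.torsionGaloisModule ((p : ℤ) ^ (d + 1))).toContRepresentation)
    (Ψt : contOneCocycles (W.modPkTwist p (d + 1) κ₁ L).toTopRep)
    (ψt : contOneCocycles (W.modPTwist p κ₁ L).toTopRep)
    (h : p ^ d • oneCocycleClass (W.modPkTwist p (d + 1) κ₁ L).toTopRep Ψt =
      galoisCohomology.map
        (κ₁.twistModPToModPk (W.torsionGaloisModule (p : ℤ)) L (W.torsionGaloisModule ((p : ℤ) ^ (d + 1)))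
          (fun P : geomTorsion W (p : ℤ) => AddSubgroup.torsionBy.nsmul P)
          (W.pow_nsmul_geomTorsion_eq_zero p (d + 1)) ι) 1
        (oneCocycleClass (W.modPTwist p κ₁ L).toTopRep ψt)) :
    ∃ b : Fin L → geomTorsion W ((p : ℤ) ^ (d + 1)), ∀ g : absoluteGaloisGroup ℚ,
      p ^ d • Ψt.1 g = (fun l => ι (ψt.1 g l)) + (W.modPkTwist p (d + 1) κ₁ L g b - b) := by
  let f := κ₁.twistModPToModPk (W.torsionGaloisModule (p : ℤ)) L (W.torsionGaloisModule ((p : ℤ) ^ (d + 1)))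
    (fun P : geomTorsion W (p : ℤ) => AddSubgroup.torsionBy.nsmul P) (W.pow_nsmul_geomTorsion_eq_zero p (d + 1)) ι
  let ψpush : contOneCocycles (W.modPkTwist p (d + 1) κ₁ L).toTopRep :=
    contOneCocycles.pullback (ContinuousMonoidHom.id (absoluteGaloisGroup ℚ))
      (X := (W.modPTwist p κ₁ L).toTopRep) (Y := (W.modPkTwist p (d + 1) κ₁ L).toTopRep)
      (TopRep.ofHom ⟨f.toContinuousLinearMap, f.isIntertwining'⟩) ψt
  have hψpush : oneCocycleClass (W.modPkTwist p (d + 1) κ₁ L).toTopRep ψpush =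
      galoisCohomology.map f 1 (oneCocycleClass (W.modPTwist p κ₁ L).toTopRep ψt) :=
    (galoisCohomology.map_oneCocycleClass_ofHom f ψt).symm
  have hcl : oneCocycleClass (W.modPkTwist p (d + 1) κ₁ L).toTopRep (p ^ d • Ψt) =
      oneCocycleClass (W.modPkTwist p (d + 1) κ₁ L).toTopRep ψpush := by
    rw [oneCocycleClass_nsmul, hψpush]
    exact h
  obtain ⟨b, hb⟩ := exists_coboundary_of_oneCocycleClass_eq _ hcl
  exact ⟨b, fun g => hb g⟩

end TestSide

/-! ## §7 A `μ_{p^k}`-valued Weil-type pairing on `E[p^k]` as a biadditive hom: alternating, non-degenerate, equivariant -/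

section WeilPk

variable {F : Type u} [Field F] (W : WeierstrassCurve F) (p : ℕ) [Fact p.Prime] (k : ℕ)
  (e : geomTorsion W ((p ^ k : ℕ) : ℤ) → geomTorsion W ((p ^ k : ℕ) : ℤ) → AlgebraicClosure F)
  (hμ : ∀ S T, e S T ^ (p ^ k) = 1) (hadd₁ : ∀ S₁ S₂ T, e (S₁ + S₂) T = e S₁ T * e S₂ T)
  (hadd₂ : ∀ S T₁ T₂, e S (T₁ + T₂) = e S T₁ * e S T₂)

/-- `powWeilPairingHom` of an alternating `e` is alternating. [cite: SilvermanAEC2009, III.§8 (Prop. 8.1 (c))] -/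
theorem powWeilPairingHom_self (halt : ∀ T, e T T = 1) (T : geomTorsion W ((p : ℤ) ^ k)) :
    W.powWeilPairingHom p k e hμ hadd₁ hadd₂ T T = 0 := by
  rw [muCarrier_eq_iff, WeierstrassCurve.coe_powWeilPairingHom, halt]
  rfl

/-- `powWeilPairingHom` of a right-non-degenerate `e` is right-non-degenerate. [cite: SilvermanAEC2009, III.§8 (Prop. 8.1 (c))] -/
theorem powWeilPairingHom_right_nondegenerate (hnd : ∀ T, (∀ S, e S T = 1) → T = 0) (T : geomTorsion W ((p : ℤ) ^ k))
    (hT : ∀ S, W.powWeilPairingHom p k e hμ hadd₁ hadd₂ S T = 0) : T = 0 := by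
  have h : W.geomTorsionPowCongr p k T = 0 := hnd _ fun S' => by
    obtain ⟨S, rfl⟩ := (W.geomTorsionPowCongr p k).surjective S'
    have h1 := hT S
    rw [muCarrier_eq_iff, WeierstrassCurve.coe_powWeilPairingHom] at h1
    exact h1
  exact (W.geomTorsionPowCongr p k).map_eq_zero_iff.mp h

/-- `powWeilPairingHom` of a Galois-equivariant `e` is equivariant into `μ_{p^k}`, in the `σ •` spelling.
[cite: SilvermanAEC2009, III.§8 (Prop. 8.1 (d))] -/
theorem powWeilPairingHom_smul_smul
    (hgal : ∀ (σ : absoluteGaloisGroup F) (S T : geomTorsion W ((p ^ k : ℕ) : ℤ)), σ • e S T = e (σ • S) (σ • T))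
    (σ : absoluteGaloisGroup F) (S T : geomTorsion W ((p : ℤ) ^ k)) :
    W.powWeilPairingHom p k e hμ hadd₁ hadd₂ (σ • S) (σ • T) =
      DiscreteGaloisModule.mu F (p ^ k) σ (W.powWeilPairingHom p k e hμ hadd₁ hadd₂ S T) := by
  rw [← WeierstrassCurve.torsionGaloisModule_apply_apply, ← WeierstrassCurve.torsionGaloisModule_apply_apply]
  exact W.powWeilPairingHom_smul p k e hμ hadd₁ hadd₂ hgal σ S T

end WeilPk

end Summit.BirchSwinnertonDyer.BirchSwinnertonDyer.Theorems.OneSidedTwistSqueezeX9KatoDivisibilityX9StubReciprocityPkX9Local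

end
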